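import Literature.NumberTheory.Transcendental.Associators

/-!
# `PentagonInKZ`, line `edge-normal-newton-leibniz`: corner engine — calculus of the dilated
# cubical word integrands, horizontal side (stub `cornerEngine_calcH`)

Stub `cornerEngine_calcH` of the crux `PentagonInKZ` (stmt-KontsevichZagierPeriods-11348, route
FurushoPentagon), line `edge-normal-newton-leibniz`.  Pure real calculus on explicit rational
functions; no KZ objects are involved.

The corner engine of the line works with the DILATED CUBICAL word integrands.  On the
horizontal side these are, for a word `u : Fin n → Fin (m + 2)` over the letters of the
bilinear divisors `φ_k(t, y) = cf k 0 + cf k 1 · t + cf k 2 · y + cf k 3 · t y` (letter `0` is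
`φ₀ = t`, letter `1` is `φ₁ = y`), the functions
`qH u x ξ η = ∏ᵢ [u i = 0 ? 1/xᵢ : (ξ x₀ ⋯ x_{i-1}) · fd (u i) (ξ x₀ ⋯ xᵢ) η]`,
where `fd k t y = ∂ₜ log φ_k (t, y) = (cf k 1 + cf k 3 · y) / φ_k(t, y)` is the horizontal
letter density.  All functions are hypothesised dictionaries (`fd` with `hfd`, `qH` with `hqH`,
the explicit `ξ`-derivative `dqH` with `hdqH`).  The theorem `cornerEngine_calcH` packages four
facts:

1. FACTORISATION at the outermost variable (`Fin.cons`):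
   `qH u (cons x₀ x') ξ η = [u 0 = 0 ? 1/x₀ : ξ · fd (u 0) (ξ x₀) η] · qH (tail u) x' (ξ x₀) η`
   (`Fin.prod_univ_succ` and the reindexing of the partial products along `Fin.succ`);
2. `HasDerivAt` in `ξ` of `s ↦ qH u x s η` with derivative `dqH u x ξ η` on the parameter box
   (product rule; each factor is a constant `1/xᵢ` or `(s P) · fd k (s Q) η` with
   `∂ₜ fd = -fd²`, the denominator `φ_k` being nonzero on the box by `hreg`, and `fd 1 = 0`);
3. EULER identity: for `x₀ ∈ (0, 1)`, `t ↦ t · qH u (cons t x') ξ η` has derivative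
   `ξ · dqH u (cons x₀ x') ξ η` at `x₀`: both `t · qH u (cons t x') ξ η = Ψ (ξ t)` and
   `qH u (cons x₀ x') s η = Ψ (s x₀) / x₀` factor through ONE smooth one-variable function
   `Ψ r = [u 0 = 0 ? 1 : r · fd (u 0) r η] · qH (tail u) x' r η`, whence the claim by the chain
   rule and uniqueness of derivatives;
4. CONTINUITY on `[0, 1]` of `t ↦ t · qH u (cons t x') ξ η` when the last letter is not `0`
   (again `t · qH = Ψ (ξ t)`, now including `t = 0` where both sides vanish).

References: M. Kontsevich, D. Zagier, *Periods* (2001), §1.2 (the rules of the calculus of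
periods these identities feed); the computations themselves are folklore calculus.
-/

noncomputable section

open Filter Topology

namespace Summit.KontsevichZagierPeriods.FurushoPentagon.PentagonInKZ

namespace CornerEngineCalcH

/-! ### Partial products along `Fin.cons` -/

section FinProducts

variable {n : ℕ}

/-- `∏_{j < 0} x_j = 1`. [folklore] -/
theorem prod_filter_lt_zero (x : Fin (n + 1) → ℝ) :
    ∏ j ∈ Finset.univ.filter (fun j : Fin (n + 1) => j < 0), x j = 1 := by
  rw [Finset.prod_filter, Fin.prod_univ_succ]
  simp

/-- `∏_{j ≤ 0} x_j = x₀`. [folklore] -/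
theorem prod_filter_le_zero (x : Fin (n + 1) → ℝ) :
    ∏ j ∈ Finset.univ.filter (fun j : Fin (n + 1) => j ≤ 0), x j = x 0 := by
  rw [Finset.prod_filter, Fin.prod_univ_succ]
  simp [Fin.succ_ne_zero]

/-- `∏_{j < i+1} (x₀, x')_j = x₀ · ∏_{j < i} x'_j`. [folklore] -/
theorem prod_filter_lt_succ (x₀ : ℝ) (x' : Fin n → ℝ) (i : Fin n) :
    ∏ j ∈ Finset.univ.filter (fun j : Fin (n + 1) => j < i.succ),
        (Fin.cons x₀ x' : Fin (n + 1) → ℝ) j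
      = x₀ * ∏ j ∈ Finset.univ.filter (fun j : Fin n => j < i), x' j := by
  rw [Finset.prod_filter, Finset.prod_filter, Fin.prod_univ_succ]
  simp [Fin.succ_lt_succ_iff]

/-- `∏_{j ≤ i+1} (x₀, x')_j = x₀ · ∏_{j ≤ i} x'_j`. [folklore] -/
theorem prod_filter_le_succ (x₀ : ℝ) (x' : Fin n → ℝ) (i : Fin n) :
    ∏ j ∈ Finset.univ.filter (fun j : Fin (n + 1) => j ≤ i.succ),
        (Fin.cons x₀ x' : Fin (n + 1) → ℝ) j
      = x₀ * ∏ j ∈ Finset.univ.filter (fun j : Fin n => j ≤ i), x' j := by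
  rw [Finset.prod_filter, Finset.prod_filter, Fin.prod_univ_succ]
  simp [Fin.succ_le_succ_iff]

end FinProducts

/-! ### One-variable calculus of the letter densities -/

/-- Derivative of the horizontal letter density `t ↦ N / (A + t N)` (`N = c₁ + c₃ y`,
`A = c₀ + c₂ y`): it is `-(N / (A + t N))²` wherever the denominator does not vanish, and also
(trivially) when `N = 0`. [folklore] -/
theorem hasDerivAt_ratio (c0 c1 c2 c3 y t₀ : ℝ)
    (h : c0 + c1 * t₀ + c2 * y + c3 * t₀ * y ≠ 0 ∨ c1 + c3 * y = 0) :
    HasDerivAt (fun t => (c1 + c3 * y) / (c0 + c1 * t + c2 * y + c3 * t * y))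
      (-((c1 + c3 * y) / (c0 + c1 * t₀ + c2 * y + c3 * t₀ * y)) ^ 2) t₀ := by
  rcases h with h | h
  · have hD : HasDerivAt (fun t => c0 + c1 * t + c2 * y + c3 * t * y) (c1 + c3 * y) t₀ :=
      (((hasDerivAt_const_mul c1).const_add c0).add_const (c2 * y)).add
        ((hasDerivAt_const_mul c3).mul_const y)
    refine ((hasDerivAt_const t₀ (c1 + c3 * y)).fun_div hD h).congr_deriv ?_
    rw [div_pow]
    ring
  · have hzero : ∀ t, (c1 + c3 * y) / (c0 + c1 * t + c2 * y + c3 * t * y) = 0 := fun t => by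
      rw [h, zero_div]
    simp_rw [hzero]
    simpa using hasDerivAt_const t₀ (0 : ℝ)

/-- Product rule for one non-regularised factor `s ↦ (s P) · g (s Q)` of the dilated cubical
integrand, given `g' = -g²` at `ξ Q`. [folklore] -/
theorem hasDerivAt_factor {g : ℝ → ℝ} (P : ℝ) {Q ξ : ℝ}
    (hg : HasDerivAt g (-(g (ξ * Q)) ^ 2) (ξ * Q)) :
    HasDerivAt (fun s => (s * P) * g (s * Q))
      (P * g (ξ * Q) - (ξ * P) * Q * (g (ξ * Q)) ^ 2) ξ := by
  have h1 : HasDerivAt (fun s => s * P) P ξ := hasDerivAt_mul_const P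
  have h2 : HasDerivAt (fun s => g (s * Q)) (-(g (ξ * Q)) ^ 2 * Q) ξ :=
    hg.comp ξ (hasDerivAt_mul_const Q)
  exact (h1.mul h2).congr_deriv (by ring)

/-! ### The hypothesised dictionary -/

section Dictionary

variable {m n : ℕ} {cf : Fin (m + 2) → Fin 4 → ℚ} {α β : ℚ}
  {fd : Fin (m + 2) → ℝ → ℝ → ℝ}
  {qH : ∀ {n : ℕ}, (Fin n → Fin (m + 2)) → (Fin n → ℝ) → ℝ → ℝ → ℝ}
  {dqH : ∀ {n : ℕ}, (Fin n → Fin (m + 2)) → (Fin n → ℝ) → ℝ → ℝ → ℝ}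
  (h1 : cf 1 = ![0, 0, 1, 0])
  (hreg : ∀ k : Fin (m + 2), k ≠ 0 → k ≠ 1 → ∀ x y : ℝ, 0 ≤ x → x ≤ (α : ℝ) → 0 ≤ y →
    y ≤ (β : ℝ) →
      (cf k 0 : ℝ) + (cf k 1 : ℝ) * x + (cf k 2 : ℝ) * y + (cf k 3 : ℝ) * x * y ≠ 0)
  (hfd : ∀ k t y, fd k t y = ((cf k 1 : ℝ) + (cf k 3 : ℝ) * y) /
    ((cf k 0 : ℝ) + (cf k 1 : ℝ) * t + (cf k 2 : ℝ) * y + (cf k 3 : ℝ) * t * y))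
  (hqH : ∀ {n : ℕ} (u : Fin n → Fin (m + 2)) (x : Fin n → ℝ) (ξ η : ℝ), qH u x ξ η =
    ∏ i, if u i = 0 then 1 / x i else (ξ * ∏ j ∈ Finset.univ.filter (fun j => j < i), x j) *
      fd (u i) (ξ * ∏ j ∈ Finset.univ.filter (fun j => j ≤ i), x j) η)
  (hdqH : ∀ {n : ℕ} (u : Fin n → Fin (m + 2)) (x : Fin n → ℝ) (ξ η : ℝ), dqH u x ξ η =
    ∑ j, (if u j = 0 then 0 else
      (∏ j' ∈ Finset.univ.filter (fun j' => j' < j), x j') *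
          fd (u j) (ξ * ∏ j' ∈ Finset.univ.filter (fun j' => j' ≤ j), x j') η -
        (ξ * ∏ j' ∈ Finset.univ.filter (fun j' => j' < j), x j') *
          (∏ j' ∈ Finset.univ.filter (fun j' => j' ≤ j), x j') *
            (fd (u j) (ξ * ∏ j' ∈ Finset.univ.filter (fun j' => j' ≤ j), x j') η) ^ 2) *
      ∏ i ∈ Finset.univ.erase j, if u i = 0 then 1 / x i else
        (ξ * ∏ j' ∈ Finset.univ.filter (fun j' => j' < i), x j') *
          fd (u i) (ξ * ∏ j' ∈ Finset.univ.filter (fun j' => j' ≤ i), x j') η)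

include hqH in
/-- (1) FACTORISATION of the dilated cubical integrand at the outermost variable. [folklore] -/
theorem qH_cons (u : Fin (n + 1) → Fin (m + 2)) (x₀ : ℝ) (x' : Fin n → ℝ) (ξ η : ℝ) :
    qH u (Fin.cons x₀ x') ξ η =
      (if u 0 = 0 then 1 / x₀ else ξ * fd (u 0) (ξ * x₀) η) * qH (Fin.tail u) x' (ξ * x₀) η := by
  rw [hqH, hqH, Fin.prod_univ_succ]
  congr 1
  · simp only [Fin.cons_zero, prod_filter_lt_zero, prod_filter_le_zero, mul_one]
  · refine Finset.prod_congr rfl fun i _ => ?_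
    simp only [Fin.tail, Fin.cons_succ, prod_filter_lt_succ, prod_filter_le_succ, mul_assoc]

include hqH in
/-- A word with a letter `≠ 0` has vanishing dilated integrand at `ξ = 0`. [folklore] -/
theorem qH_zero (w : Fin n → Fin (m + 2)) (x : Fin n → ℝ) (η : ℝ) (i : Fin n) (hi : w i ≠ 0) :
    qH w x 0 η = 0 := by
  rw [hqH]
  exact Finset.prod_eq_zero (Finset.mem_univ i) (by simp [hi])

include hqH in
/-- `t · qH u (t, x') ξ η = Ψ (ξ t)` for `t ≠ 0`. [folklore] -/
theorem mul_qH_cons (u : Fin (n + 1) → Fin (m + 2)) (x' : Fin n → ℝ) (ξ η t : ℝ) (ht : t ≠ 0) :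
    t * qH u (Fin.cons t x') ξ η =
      (if u 0 = 0 then 1 else (ξ * t) * fd (u 0) (ξ * t) η) * qH (Fin.tail u) x' (ξ * t) η := by
  rw [qH_cons hqH]
  split_ifs with h0
  · rw [← mul_assoc, one_div, mul_inv_cancel₀ ht]
  · ring

include hqH in
/-- `qH u (x₀, x') s η = Ψ (s x₀) / x₀` for `x₀ ≠ 0`. [folklore] -/
theorem qH_cons_eq (u : Fin (n + 1) → Fin (m + 2)) (x₀ : ℝ) (x' : Fin n → ℝ) (s η : ℝ)
    (hx₀ : x₀ ≠ 0) :
    qH u (Fin.cons x₀ x') s η = 1 / x₀ *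
      ((if u 0 = 0 then 1 else (s * x₀) * fd (u 0) (s * x₀) η) * qH (Fin.tail u) x' (s * x₀) η) := by
  rw [qH_cons hqH]
  split_ifs with h0
  · rw [one_mul]
  · rw [← mul_assoc]
    congr 1
    field_simp

include h1 hreg hfd in
/-- The horizontal letter density has `t`-derivative `-fd²` on the parameter box (letters `≠ 0`;
for the letter `1` both sides vanish identically). [folklore] -/
theorem hasDerivAt_fd {k : Fin (m + 2)} (hk : k ≠ 0) {t₀ y : ℝ} (ht : 0 ≤ t₀) (ht' : t₀ ≤ α)
    (hy : 0 ≤ y) (hy' : y ≤ β) :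
    HasDerivAt (fun t => fd k t y) (-(fd k t₀ y) ^ 2) t₀ := by
  simp only [hfd]
  apply hasDerivAt_ratio
  by_cases hk1 : k = 1
  · right
    subst hk1
    simp [h1]
  · left
    exact hreg k hk hk1 t₀ y ht ht' hy hy'

include h1 hreg hfd hqH hdqH in
/-- (2) the `ξ`-derivative of the dilated cubical integrand on the parameter box. [folklore] -/
theorem hasDerivAt_qH (u : Fin n → Fin (m + 2)) (x : Fin n → ℝ) (ξ η : ℝ)
    (hx : ∀ i, 0 ≤ x i ∧ x i ≤ 1) (hξ : 0 ≤ ξ) (hξ' : ξ ≤ α) (hη : 0 ≤ η) (hη' : η ≤ β) :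
    HasDerivAt (fun s => qH u x s η) (dqH u x ξ η) ξ := by
  have hQ : ∀ i : Fin n, 0 ≤ ∏ j ∈ Finset.univ.filter (fun j => j ≤ i), x j ∧
      ∏ j ∈ Finset.univ.filter (fun j => j ≤ i), x j ≤ 1 := fun i =>
    ⟨Finset.prod_nonneg fun j _ => (hx j).1,
      Finset.prod_le_one (fun j _ => (hx j).1) fun j _ => (hx j).2⟩
  simp only [hqH, hdqH]
  have key : ∀ i ∈ Finset.univ, HasDerivAt
      (fun s => if u i = 0 then 1 / x i else
        (s * ∏ j ∈ Finset.univ.filter (fun j => j < i), x j) *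
          fd (u i) (s * ∏ j ∈ Finset.univ.filter (fun j => j ≤ i), x j) η)
      (if u i = 0 then 0 else
        (∏ j' ∈ Finset.univ.filter (fun j' => j' < i), x j') *
            fd (u i) (ξ * ∏ j' ∈ Finset.univ.filter (fun j' => j' ≤ i), x j') η -
          (ξ * ∏ j' ∈ Finset.univ.filter (fun j' => j' < i), x j') *
            (∏ j' ∈ Finset.univ.filter (fun j' => j' ≤ i), x j') *
              (fd (u i) (ξ * ∏ j' ∈ Finset.univ.filter (fun j' => j' ≤ i), x j') η) ^ 2) ξ := by
    intro i _
    by_cases hi : u i = 0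
    · simp only [hi, ↓reduceIte]
      exact hasDerivAt_const _ _
    · simp only [hi, ↓reduceIte]
      exact hasDerivAt_factor (∏ j ∈ Finset.univ.filter (fun j => j < i), x j)
        (hasDerivAt_fd h1 hreg hfd hi (mul_nonneg hξ (hQ i).1)
          ((mul_le_of_le_one_right hξ (hQ i).2).trans hξ') hη hη')
  refine (HasDerivAt.fun_finsetProd key).congr_deriv ?_
  exact Finset.sum_congr rfl fun j _ => by rw [smul_eq_mul]; ring

include h1 hreg hfd hqH hdqH in
/-- The one-variable function `Ψ r = [u 0 = 0 ? 1 : r · fd (u 0) r η] · qH (tail u) x' r η` is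
differentiable on `[0, α]`. [folklore] -/
theorem hasDerivAt_psi (u : Fin (n + 1) → Fin (m + 2)) (x' : Fin n → ℝ) (η r : ℝ)
    (hx : ∀ i, 0 ≤ x' i ∧ x' i ≤ 1) (hr : 0 ≤ r) (hr' : r ≤ α) (hη : 0 ≤ η) (hη' : η ≤ β) :
    ∃ D, HasDerivAt
      (fun r => (if u 0 = 0 then 1 else r * fd (u 0) r η) * qH (Fin.tail u) x' r η) D r := by
  have h2 := hasDerivAt_qH h1 hreg hfd hqH hdqH (Fin.tail u) x' r η hx hr hr' hη hη'
  by_cases h0 : u 0 = 0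
  · simp only [h0, ↓reduceIte, one_mul]
    exact ⟨_, h2⟩
  · simp only [h0, ↓reduceIte]
    exact ⟨_, ((hasDerivAt_id' r).mul (hasDerivAt_fd h1 hreg hfd h0 hr hr' hη hη')).mul h2⟩

include h1 hreg hfd hqH hdqH in
/-- (3) EULER identity at the outermost variable. [folklore] -/
theorem hasDerivAt_mul_qH_cons (u : Fin (n + 1) → Fin (m + 2)) (x₀ : ℝ) (x' : Fin n → ℝ)
    (ξ η : ℝ) (hx₀ : 0 < x₀) (hx₀' : x₀ < 1) (hx : ∀ i, 0 ≤ x' i ∧ x' i ≤ 1) (hξ : 0 ≤ ξ)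
    (hξ' : ξ ≤ α) (hη : 0 ≤ η) (hη' : η ≤ β) :
    HasDerivAt (fun t => t * qH u (Fin.cons t x') ξ η) (ξ * dqH u (Fin.cons x₀ x') ξ η) x₀ := by
  have hx0 : x₀ ≠ 0 := hx₀.ne'
  have hr : 0 ≤ ξ * x₀ := mul_nonneg hξ hx₀.le
  have hr' : ξ * x₀ ≤ α := (mul_le_of_le_one_right hξ hx₀'.le).trans hξ'
  obtain ⟨D, hD⟩ := hasDerivAt_psi h1 hreg hfd hqH hdqH u x' η (ξ * x₀) hx hr hr' hη hη'
  have hcons : ∀ i, 0 ≤ (Fin.cons x₀ x' : Fin (n + 1) → ℝ) i ∧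
      (Fin.cons x₀ x' : Fin (n + 1) → ℝ) i ≤ 1 := by
    intro i
    refine Fin.cases ?_ (fun j => ?_) i
    · simpa using ⟨hx₀.le, hx₀'.le⟩
    · simpa using hx j
  have hG := hasDerivAt_qH h1 hreg hfd hqH hdqH u (Fin.cons x₀ x') ξ η hcons hξ hξ' hη hη'
  have hG' : HasDerivAt (fun s => qH u (Fin.cons x₀ x') s η) D ξ := by
    have hc := (hD.comp ξ (hasDerivAt_mul_const x₀)).const_mul (1 / x₀)
    rw [show 1 / x₀ * (D * x₀) = D by field_simp] at hc
    exact hc.congr_of_eventuallyEq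
      (Eventually.of_forall fun s => qH_cons_eq hqH u x₀ x' s η hx0)
  have hDeq : D = dqH u (Fin.cons x₀ x') ξ η := hG'.unique hG
  rw [← hDeq, mul_comm]
  refine (hD.comp x₀ (hasDerivAt_const_mul ξ)).congr_of_eventuallyEq ?_
  filter_upwards [eventually_ne_nhds hx0] with t ht
  exact mul_qH_cons hqH u x' ξ η t ht

include h1 hreg hfd hqH hdqH in
/-- (4) CONTINUITY on `[0, 1]` in the outermost variable when the last letter is not `0`.
[folklore] -/
theorem continuousOn_mul_qH_cons (u : Fin (n + 1) → Fin (m + 2)) (x' : Fin n → ℝ) (ξ η : ℝ)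
    (hu : u (Fin.last n) ≠ 0) (hx : ∀ i, 0 ≤ x' i ∧ x' i ≤ 1) (hξ : 0 ≤ ξ) (hξ' : ξ ≤ α)
    (hη : 0 ≤ η) (hη' : η ≤ β) :
    ContinuousOn (fun t => t * qH u (Fin.cons t x') ξ η) (Set.Icc 0 1) := by
  have hcont : ∀ t ∈ Set.Icc (0 : ℝ) 1, ContinuousAt
      ((fun r => (if u 0 = 0 then 1 else r * fd (u 0) r η) * qH (Fin.tail u) x' r η) ∘
        fun t => ξ * t) t := by
    intro t ht
    have hr : 0 ≤ ξ * t := mul_nonneg hξ ht.1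
    have hr' : ξ * t ≤ α := (mul_le_of_le_one_right hξ ht.2).trans hξ'
    obtain ⟨D, hD⟩ := hasDerivAt_psi h1 hreg hfd hqH hdqH u x' η (ξ * t) hx hr hr' hη hη'
    exact (hD.comp t (hasDerivAt_const_mul ξ)).continuousAt
  refine (continuousOn_of_forall_continuousAt hcont).congr ?_
  intro t ht
  simp only [Function.comp_apply]
  rcases eq_or_ne t 0 with rfl | ht0
  · rw [zero_mul, mul_zero]
    by_cases h0 : u 0 = 0
    · simp only [h0, ↓reduceIte, one_mul]
      rcases Fin.eq_zero_or_eq_succ (Fin.last n) with h | ⟨j, hj⟩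
      · rw [h] at hu
        exact absurd h0 hu
      · rw [hj] at hu
        exact (qH_zero hqH (Fin.tail u) x' η j hu).symm
    · simp [h0]
  · exact mul_qH_cons hqH u x' ξ η t ht0

end Dictionary

end CornerEngineCalcH

/-- **Corner engine, horizontal calculus** (stub `cornerEngine_calcH` of the line
`edge-normal-newton-leibniz`).  For the hypothesised dictionary of horizontal letter densities
`fd k t y = (cf k 1 + cf k 3 · y) / φ_k(t, y)` and dilated cubical word integrands
`qH u x ξ η = ∏ᵢ [u i = 0 ? 1/xᵢ : (ξ x₀⋯x_{i-1}) · fd (u i) (ξ x₀⋯xᵢ) η]` with explicit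
`ξ`-derivative `dqH`: (1) the factorisation of `qH` at the outermost cubical variable, (2)
`∂_ξ qH = dqH` on the parameter box `x ∈ [0,1]ⁿ`, `ξ ∈ [0, α]`, `η ∈ [0, β]`, (3) the Euler
identity `∂ₜ (t · qH u (t, x') ξ η) = ξ · dqH u (x₀, x') ξ η` at `t = x₀ ∈ (0, 1)`, and (4) the
continuity of `t ↦ t · qH u (t, x') ξ η` on `[0, 1]` when the last letter of `u` is not `0`.
These are the calculus inputs of the Newton–Leibniz move of the calculus of periods
[cite: KontsevichZagier2001, §1.2]. -/
theorem cornerEngine_calcH :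
    ∀ (m : ℕ) (cf : Fin (m + 2) → Fin 4 → ℚ) (α β : ℚ) (h0 : cf 0 = ![0, 1, 0, 0]) (h1 : cf 1 = ![0, 0, 1, 0]) (hreg : ∀ k : Fin (m + 2), k ≠ 0 → k ≠ 1 → ∀ x y : ℝ, 0 ≤ x → x ≤ (α : ℝ) → 0 ≤ y → y ≤ (β : ℝ) → (cf k 0 : ℝ) + (cf k 1 : ℝ) * x + (cf k 2 : ℝ) * y + (cf k 3 : ℝ) * x * y ≠ 0) (fd : Fin (m + 2) → ℝ → ℝ → ℝ) (hfd : ∀ k t y, fd k t y = ((cf k 1 : ℝ) + (cf k 3 : ℝ) * y) / ((cf k 0 : ℝ) + (cf k 1 : ℝ) * t + (cf k 2 : ℝ) * y + (cf k 3 : ℝ) * t * y)) (qH : ∀ {n : ℕ}, (Fin n → Fin (m + 2)) → (Fin n → ℝ) → ℝ → ℝ → ℝ) (hqH : ∀ {n : ℕ} (u : Fin n → Fin (m + 2)) (x : Fin n → ℝ) (ξ η : ℝ), qH u x ξ η = ∏ i, if u i = 0 then 1 / x i else (ξ * ∏ j ∈ Finset.univ.filter (fun j => j < i), x j) * fd (u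 i) (ξ * ∏ j ∈ Finset.univ.filter (fun j => j ≤ i), x j) η) (dqH : ∀ {n : ℕ}, (Fin n → Fin (m + 2)) → (Fin n → ℝ) → ℝ → ℝ → ℝ) (hdqH : ∀ {n : ℕ} (u : Fin n → Fin (m + 2)) (x : Fin n → ℝ) (ξ η : ℝ), dqH u x ξ η = ∑ j, (if u j = 0 then 0 else (∏ j' ∈ Finset.univ.filter (fun j' => j' < j), x j') * fd (u j) (ξ * ∏ j' ∈ Finset.univ.filter (fun j' => j' ≤ j), x j') η - (ξ * ∏ j' ∈ Finset.univ.filter (fun j' => j' < j), x j') * (∏ j' ∈ Finset.univ.filter (fun j' => j' ≤ j), x j') * (fd (u j) (ξ * ∏ j' ∈ Finset.univ.filter (fun j' => j' ≤ j), x j') η) ^ 2) * ∏ i ∈ Finset.univ.erase j, if u i = 0 then 1 / x i else (ξ * ∏ j' ∈ Finset.univ.filter (fun j' => j' < i), x j') * fd (u i) (ξ * ∏ j' ∈ Finset.univ.filter (fun j' => j' ≤ i), x j') η), (∀ {n : ℕ} (u : Fin (n + 1) → Fin (m + 2)) (x₀ : ℝ) (x' : Fin n → ℝ) (ξ η : ℝ),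 qH u (Fin.cons x₀ x') ξ η = (if u 0 = 0 then 1 / x₀ else ξ * fd (u 0) (ξ * x₀) η) * qH (Fin.tail u) x' (ξ * x₀) η) ∧ (∀ {n : ℕ} (u : Fin n → Fin (m + 2)) (x : Fin n → ℝ) (ξ η : ℝ), (∀ i, 0 ≤ x i ∧ x i ≤ 1) → 0 ≤ ξ → ξ ≤ (α : ℝ) → 0 ≤ η → η ≤ (β : ℝ) → HasDerivAt (fun s => qH u x s η) (dqH u x ξ η) ξ) ∧ (∀ {n : ℕ} (u : Fin (n + 1) → Fin (m + 2)) (x₀ : ℝ) (x' : Fin n → ℝ) (ξ η : ℝ), 0 < x₀ → x₀ < 1 → (∀ i, 0 ≤ x' i ∧ x' i ≤ 1) → 0 ≤ ξ → ξ ≤ (α : ℝ) → 0 ≤ η → η ≤ (β : ℝ) → HasDerivAt (fun t => t * qH u (Fin.cons t x') ξ η) (ξ * dqH u (Fin.cons x₀ x') ξ η) x₀) ∧ (∀ {n : ℕ} (u : Fin (n + 1) → Fin (m + 2)) (x' : Fin n → ℝ) (ξ η : ℝ), u (Fin.last n) ≠ 0 → (∀ i, 0 ≤ x' i ∧ x'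 i ≤ 1) → 0 ≤ ξ → ξ ≤ (α : ℝ) → 0 ≤ η → η ≤ (β : ℝ) → ContinuousOn (fun t => t * qH u (Fin.cons t x') ξ η) (Set.Icc 0 1) ∧ (0 : ℝ) * qH u (Fin.cons 0 x') ξ η = 0) := by
  intro m cf α β _ h1 hreg fd hfd qH hqH dqH hdqH
  refine ⟨fun u x₀ x' ξ η => CornerEngineCalcH.qH_cons hqH u x₀ x' ξ η,
    fun u x ξ η hx hξ hξ' hη hη' =>
      CornerEngineCalcH.hasDerivAt_qH h1 hreg hfd hqH hdqH u x ξ η hx hξ hξ' hη hη',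
    fun u x₀ x' ξ η hx₀ hx₀' hx hξ hξ' hη hη' =>
      CornerEngineCalcH.hasDerivAt_mul_qH_cons h1 hreg hfd hqH hdqH u x₀ x' ξ η hx₀ hx₀' hx hξ
        hξ' hη hη',
    fun u x' ξ η hu hx hξ hξ' hη hη' =>
      ⟨CornerEngineCalcH.continuousOn_mul_qH_cons h1 hreg hfd hqH hdqH u x' ξ η hu hx hξ hξ' hη
        hη', zero_mul _⟩⟩

end Summit.KontsevichZagierPeriods.FurushoPentagon.PentagonInKZ
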